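import Summits.BirchSwinnertonDyer.BirchSwinnertonDyer.Theorems.ThetaPartnerAtTwoSignedKatoUpToAtTwoCuspFactorCharacter
import Summits.BirchSwinnertonDyer.BirchSwinnertonDyer.Theorems.ThetaPartnerAtTwoSignedKatoUpToAtTwoCuspFactorSpan
import Summits.BirchSwinnertonDyer.BirchSwinnertonDyer.Theorems.ThetaPartnerAtTwoSignedKatoUpToAtTwoCuspFactorOddCharacters
import Summits.BirchSwinnertonDyer.Rank2.FrobeniusExponentsAtTwoSmall
import HarnessLib

/-!
# Route `ThetaPartnerAtTwo` (TP2), crux K3 `SignedKatoDivisibilityUpToAtTwo` (stmt-BirchSwinnertonDyer-20308 / K3P′ 25631), line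
# `colemanrat` v12 — CUSP-FACTOR GENERATION: for every height-one prime `𝔭 ∌ 2` of `Λ = ℤ₂⟦T⟧` some admissible `(c, d)` puts the
# four-term cusp element OUTSIDE `𝔭` (Kato's Thm. 12.6 / §13.12 step, at `p = 2`, over `ℤ₂⟦T⟧`, without auxiliary character)

Width seat `bsd-wall-tp2-p2x-w2` g6 (cell `bsd-wall`). HONEST FRAMING: theorems only (no definition, no named fact, no instance, no
`sorry`); closes no item; K3 / K3P′ are NOT settled and BSD is NOT proved by any of this.

## Statement (memo `Cruxes/SignedKatoDivisibilityUpToAtTwo/W2G6-KATO1312-AT2.md` §2)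

Data: a level `2^e` (`e ≥ 3`); an INTEGER-valued function `t` on `G_e = (ℤ/2^e)^×` with `t(1) ≠ 0` and three distinct characters
`ψ_i : G_e → ℂ` with `∑_b ψ_i(b)t(b) ≠ 0` (in the K3 assembly: `t(b) = D·[ab/2^e]⁻_f`, supplied by `…CuspFactorOddTwistSupply` from
Rohrlich + odd Birch); avoidance moduli `Qc` (prime to `10`) and `Qd` (odd) (Kato's guards `(c, 6·2·A) = 1`, `(d, 6·2·N) = 1` with `A = 2^e`:
`Qc = 3`, `Qd = 3N`); a twist `η ∈ ℤ₂` of the exponent (`U_x = (1+T)^{η·ℓ(x)}`, `ℓ = CyclotomicZp.ell 2`; `η = ±1` or a unit according to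
the normalisation of the cyclotomic variable); a height-one prime `𝔭` of `Λ` with `2 ∉ 𝔭`. Conclusion
(`exists_cuspElement_not_mem`): there are natural numbers `c, d` prime to `2Qc`, `2Qd`, with `2`-adic units `u_c, u_d` and classes
`c̄, d̄ ∈ G_e`, such that
`C(c²d²t(1)) − C(cd²t(c̄))·(1+T)^{ηℓ(u_c)} − C(c²d t(d̄⁻¹))·(1+T)^{ηℓ(u_d)} + C(cd t(c̄d̄⁻¹))·(1+T)^{ηℓ(u_c)}(1+T)^{ηℓ(u_d)} ∉ 𝔭`.

## Proof
Evaluate at a `ℂ₂`-root `z₀` of `𝔭` (`CuspEval.exists_point_of_height_one`): it suffices to make the value non-zero. Let `K = 2^{e−2}`,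
`w = (1+T)^{ηK}(z₀)`. GENERIC root (`w ≠ 5^K`): `c = 5^K` (`≡ 1 (2^e)`, `ℓ(c) = K`), `d ≡ 5^K (mod 2^M)`, `d ≡ 1 (mod Qd)` with `M = e + n`,
`2^{−n} < δ` where `δ` is a continuity modulus of `a ↦ (1+T)^{ηKa}(z₀) − 5^{Ka}` at `a = 1` (value `w − 5^K ≠ 0`; continuity from
`…CuspFactorEvaluation`); then `ℓ(d) = K(1 + 2^n b)` and `(1+T)^{ηℓ(d)}(z₀) ≠ d`, and the value is `t(1)·c(c − w)·d(d − (1+T)^{ηℓ(d)}(z₀)) ≠ 0`.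
EXCEPTIONAL root (`w = 5^K`): `(1+T)^{ηℓ(x)}(z₀) = x·θ(x̄)` for a character `θ` of `G_e` (`…CuspFactorCharacter`), the value is
`c²d²·B_{θ,θ}(c̄, d̄)` with the cusp bracket of `…CuspFactorSpan`, and `CuspSpan.exists_bracket_ne_zero` (fed by the three `ψ_i`) gives a
class pair with non-zero bracket, lifted to admissible `c, d` by the Chinese remainder theorem.

References: [Kato2004Asterisque] K. Kato, Astérisque 295 (2004), Thm. 12.6 (p. 222), §13.9–13.12 (pp. 229–233), Thm. 13.5 (2) (p. 227);
[Washington1997] §7.1–7.2, §13.2.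
-/

set_option autoImplicit false
-- the Theorems namespace of this sub repeats the summit name by design (D-0017 nested layout)
set_option linter.dupNamespace false

noncomputable section

open scoped BigOperators

open Literature.NumberTheory.EllipticCurves Literature.NumberTheory.EllipticCurves.CyclotomicZp
  Literature.NumberTheory.EllipticCurves.PadicOneUnits

namespace Summit.BirchSwinnertonDyer.BirchSwinnertonDyer.Theorems.SignedKatoOffTwo.CuspEval

/-- `5^{2^{e−2}} ≡ 1 (mod 2^e)` (`e ≥ 3`). [cite: Washington1997, §7.2] -/
theorem five_pow_K_cast_eq_one {e : ℕ} (he : 3 ≤ e) : ((5 ^ 2 ^ (e - 2) : ℕ) : ZMod (2 ^ e)) = 1 := by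
  have h := OddTwistSupply.five_pow_sq_eq_one he
  rw [← pow_mul, ← pow_succ, show e - 3 + 1 = e - 2 by omega] at h
  exact_mod_cast h

/-- **CUSP-FACTOR GENERATION** (the `ℤ₂⟦T⟧`-form of Kato's §13.12 step at `p = 2`). See the module docstring for the data. For every
height-one prime `𝔭` of `Λ = ℤ₂⟦T⟧` with `2 ∉ 𝔭` there are admissible `c, d` (prime to `2Qc`, `2Qd`) with units `u_c, u_d ∈ ℤ₂^×` and
classes `c̄, d̄ ∈ (ℤ/2^e)^×` such that the four-term cusp element
`C(c²d²t(1)) − C(cd²t(c̄))·(1+T)^{ηℓ(u_c)} − C(c²d t(d̄⁻¹))·(1+T)^{ηℓ(u_d)} + C(cd t(c̄d̄⁻¹))·(1+T)^{ηℓ(u_c)}·(1+T)^{ηℓ(u_d)}`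
(`(1+T)^a = PowerSeries.binomialSeries ℤ_[2] a`, `ℓ = CyclotomicZp.ell 2`) does NOT lie in `𝔭`. Inputs: `t(1) ≠ 0` and three distinct
characters `ψ_i` of `(ℤ/2^e)^×` with `∑ ψ_i·t ≠ 0` (from Rohrlich via `…CuspFactorOddTwistSupply` in the application). Proof: evaluation at a
`ℂ₂`-root of `𝔭`; generic root — `c = 5^{2^{e−2}}`, `d` a `2`-adic approximation of it prime to `2Qd`, continuity of `a ↦ (1+T)^a(z₀)`;
exceptional root — the character `θ` of `…CuspFactorCharacter` and the span lemma `CuspSpan.exists_bracket_ne_zero`.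
[cite: Kato2004Asterisque, Thm. 12.6 (p. 222), §13.12 (pp. 231–233)] -/
theorem exists_cuspElement_not_mem {e : ℕ} (he : 3 ≤ e) (t : (ZMod (2 ^ e))ˣ → ℤ) (ht1 : t 1 ≠ 0)
    (ψ : Fin 3 → ((ZMod (2 ^ e))ˣ →* ℂ)) (hψ : Function.Injective ψ)
    (hne : ∀ i, ∑ b : (ZMod (2 ^ e))ˣ, ψ i b * (t b : ℂ) ≠ 0)
    {Qc Qd : ℕ} (hQc2 : Nat.Coprime 2 Qc) (hQc5 : Nat.Coprime 5 Qc) (hQd : Nat.Coprime 2 Qd) (η : ℤ_[2])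
    (𝔭 : PrimeSpectrum (IwasawaAlgebra 2)) (h𝔭 : 𝔭.asIdeal.height = 1) (h2 : PowerSeries.C (2 : ℤ_[2]) ∉ 𝔭.asIdeal) :
    ∃ (c d : ℕ) (uc ud : ℤ_[2]ˣ) (cb db : (ZMod (2 ^ e))ˣ),
      (uc : ℤ_[2]) = c ∧ (ud : ℤ_[2]) = d ∧ (cb : ZMod (2 ^ e)) = c ∧ (db : ZMod (2 ^ e)) = d ∧
      Nat.Coprime c (2 * Qc) ∧ Nat.Coprime d (2 * Qd) ∧
      PowerSeries.C ((c ^ 2 * d ^ 2 * t 1 : ℤ) : ℤ_[2])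
          - PowerSeries.C ((c * d ^ 2 * t cb : ℤ) : ℤ_[2]) * PowerSeries.binomialSeries ℤ_[2] (η * ell 2 uc)
          - PowerSeries.C ((c ^ 2 * d * t db⁻¹ : ℤ) : ℤ_[2]) * PowerSeries.binomialSeries ℤ_[2] (η * ell 2 ud)
          + PowerSeries.C ((c * d * t (cb * db⁻¹) : ℤ) : ℤ_[2]) * PowerSeries.binomialSeries ℤ_[2] (η * ell 2 uc) *
              PowerSeries.binomialSeries ℤ_[2] (η * ell 2 ud) ∉ 𝔭.asIdeal := by
  classical
  haveI : NeZero (2 ^ e) := ⟨pow_ne_zero _ two_ne_zero⟩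
  set ι := (algebraMap ℚ_[2] ℂ_[2]).comp (algebraMap ℤ_[2] ℚ_[2]) with hι
  have hιinj : Function.Injective ι := by
    rw [hι]; exact (algebraMap ℚ_[2] ℂ_[2]).injective.comp (IsFractionRing.injective ℤ_[2] ℚ_[2])
  have hιint : ∀ n : ℤ, ι (n : ℤ_[2]) = (n : ℂ_[2]) := fun n ↦ map_intCast ι n
  have hιnat : ∀ n : ℕ, ι (n : ℤ_[2]) = (n : ℂ_[2]) := fun n ↦ map_natCast ι n
  -- a `ℂ₂`-root of `𝔭`
  obtain ⟨z, hz, hvan⟩ := exists_point_of_height_one 𝔭 h𝔭 (by exact_mod_cast h2)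
  -- notation-free evaluation of `(1+T)^{a}` at `z`
  set K : ℕ := 2 ^ (e - 2) with hK
  have hKpos : 0 < K := pow_pos two_pos _
  set w : ℂ_[2] := ∑' k, ι (PowerSeries.coeff k (PowerSeries.binomialSeries ℤ_[2] (η * K))) * z ^ k with hw
  -- it suffices to make the value at `z` non-zero
  suffices H : ∃ (c d : ℕ) (uc ud : ℤ_[2]ˣ) (cb db : (ZMod (2 ^ e))ˣ),
      (uc : ℤ_[2]) = c ∧ (ud : ℤ_[2]) = d ∧ (cb : ZMod (2 ^ e)) = c ∧ (db : ZMod (2 ^ e)) = d ∧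
      Nat.Coprime c (2 * Qc) ∧ Nat.Coprime d (2 * Qd) ∧
      ι ((c ^ 2 * d ^ 2 * t 1 : ℤ) : ℤ_[2])
        - ι ((c * d ^ 2 * t cb : ℤ) : ℤ_[2]) *
            (∑' k, ι (PowerSeries.coeff k (PowerSeries.binomialSeries ℤ_[2] (η * ell 2 uc))) * z ^ k)
        - ι ((c ^ 2 * d * t db⁻¹ : ℤ) : ℤ_[2]) *
            (∑' k, ι (PowerSeries.coeff k (PowerSeries.binomialSeries ℤ_[2] (η * ell 2 ud))) * z ^ k)
        + ι ((c * d * t (cb * db⁻¹) : ℤ) : ℤ_[2]) *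
            (∑' k, ι (PowerSeries.coeff k (PowerSeries.binomialSeries ℤ_[2] (η * ell 2 uc))) * z ^ k) *
            (∑' k, ι (PowerSeries.coeff k (PowerSeries.binomialSeries ℤ_[2] (η * ell 2 ud))) * z ^ k) ≠ 0 by
    obtain ⟨c, d, uc, ud, cb, db, h1, h2', h3, h4, h5, h6, hval⟩ := H
    refine ⟨c, d, uc, ud, cb, db, h1, h2', h3, h4, h5, h6, fun hmem ↦ hval ?_⟩
    rw [← tsum_coeff_cuspElement hz]
    exact hvan _ hmem
  by_cases hE : w = ι (cycPow 2 K)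
  · /- EXCEPTIONAL root: the character `θ` and the span lemma -/
    obtain ⟨θ, hθ⟩ := exists_character_of_exceptional hz η (e := e) (by omega) (by rw [← hK]; exact hE)
    have hne' : ∀ i, ∑ b : (ZMod (2 ^ e))ˣ, ψ i b * (((fun b ↦ (t b : ℚ)) b : ℚ) : ℂ) ≠ 0 := fun i ↦ by
      simpa only [Rat.cast_intCast] using hne i
    obtain ⟨cb, db, hB⟩ := CuspSpan.exists_bracket_ne_zero (L := ℂ_[2]) θ θ (fun b ↦ (t b : ℚ)) ψ hψ hne'
    simp only [Rat.cast_intCast] at hB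
    -- lift the classes to admissible naturals
    obtain ⟨c, hc, hcQ⟩ := exists_natCast_eq_coprime (p := 2) (e := e) (by omega) hQc2 cb
    obtain ⟨d, hd, hdQ⟩ := exists_natCast_eq_coprime (p := 2) (e := e) (by omega) hQd db
    have hc2 : ¬ 2 ∣ c := fun h ↦ by
      have := Nat.Coprime.coprime_dvd_right (dvd_mul_right 2 Qc) hcQ
      rw [Nat.coprime_two_right] at this
      exact this.not_two_dvd_nat h
    have hd2 : ¬ 2 ∣ d := fun h ↦ by
      have := Nat.Coprime.coprime_dvd_right (dvd_mul_right 2 Qd) hdQ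
      rw [Nat.coprime_two_right] at this
      exact this.not_two_dvd_nat h
    obtain ⟨uc, huc⟩ := exists_unit_eq_natCast (p := 2) hc2
    obtain ⟨ud, hud⟩ := exists_unit_eq_natCast (p := 2) hd2
    have hπc : Units.map (PadicInt.toZModPow e : ℤ_[2] →+* ZMod (2 ^ e)).toMonoidHom uc = cb :=
      Units.ext (by rw [coe_unitsMap_of_coe_eq_natCast uc huc, hc])
    have hπd : Units.map (PadicInt.toZModPow e : ℤ_[2] →+* ZMod (2 ^ e)).toMonoidHom ud = db :=
      Units.ext (by rw [coe_unitsMap_of_coe_eq_natCast ud hud, hd])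
    refine ⟨c, d, uc, ud, cb, db, huc, hud, hc.symm, hd.symm, hcQ, hdQ, ?_⟩
    rw [hθ uc, hθ ud, hπc, hπd, huc, hud, hιint, hιint, hιint, hιint, hιnat, hιnat]
    push_cast
    have hc0 : (c : ℂ_[2]) ≠ 0 := by exact_mod_cast (show c ≠ 0 from fun h ↦ hc2 (h ▸ dvd_zero 2))
    have hd0 : (d : ℂ_[2]) ≠ 0 := by exact_mod_cast (show d ≠ 0 from fun h ↦ hd2 (h ▸ dvd_zero 2))
    intro h0
    apply hB
    have hcd : ((c : ℂ_[2]) ^ 2 * (d : ℂ_[2]) ^ 2) ≠ 0 := mul_ne_zero (pow_ne_zero _ hc0) (pow_ne_zero _ hd0)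
    have key : (c : ℂ_[2]) ^ 2 * (d : ℂ_[2]) ^ 2 *
        ((t 1 : ℂ_[2]) - θ cb * (t cb : ℂ_[2]) - θ db * (t db⁻¹ : ℂ_[2]) + θ cb * θ db * (t (cb * db⁻¹) : ℂ_[2])) = 0 := by
      linear_combination h0
    exact (mul_eq_zero.mp key).resolve_left hcd
  · /- GENERIC root: `c = 5^K`, `d` a `2`-adic approximation of `5^K` -/
    -- `c`
    set c : ℕ := 5 ^ K with hc
    have hc_cast : (c : ℤ_[2]) = cycPow 2 K := by
      rw [hc, Summit.BirchSwinnertonDyer.Rank2.LevelFifteen.cycPow_two_natCast]; push_cast; rfl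
    set uc : ℤ_[2]ˣ := cycPowUnit 2 K with huc_def
    have huc : (uc : ℤ_[2]) = c := by rw [huc_def, val_cycPowUnit, hc_cast]
    have hell_c : ell 2 uc = K := ell_cycPowUnit 2 K
    have hgc : ∑' k, ι (PowerSeries.coeff k (PowerSeries.binomialSeries ℤ_[2] (η * ell 2 uc))) * z ^ k = w := by
      rw [hell_c]
    have hc2 : ¬ 2 ∣ c := by
      rw [hc]; intro h
      exact absurd (Nat.Prime.dvd_of_dvd_pow Nat.prime_two h) (by norm_num)
    have hcQ : Nat.Coprime c (2 * Qc) := by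
      rw [hc]
      exact Nat.Coprime.pow_left _ (Nat.Coprime.mul_right (by norm_num) hQc5)
    have hcmod : (c : ZMod (2 ^ e)) = 1 := by rw [hc, hK]; exact five_pow_K_cast_eq_one he
    -- continuity modulus at `a = 1`
    let φ : ℤ_[2] → ℂ_[2] := fun a ↦
      (∑' k, ι (PowerSeries.coeff k (PowerSeries.binomialSeries ℤ_[2] (η * K * a))) * z ^ k) - ι (cycPow 2 (K * a))
    have hιcont : Continuous ι := by
      refine AddMonoidHomClass.continuous_of_bound ι 1 fun b ↦ ?_
      rw [hι, RingHom.comp_apply, norm_algebraMap', PadicInt.algebraMap_apply, PadicInt.padic_norm_e_of_padicInt, one_mul]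
    have hφ : Continuous φ :=
      ((continuous_tsum_binomialSeries hz).comp (continuous_const.mul continuous_id)).sub
        (hιcont.comp ((continuous_oneAddPow (p := 2) _).comp (continuous_const.mul continuous_id)))
    have hφ1 : φ 1 ≠ 0 := by
      simp only [φ, mul_one]
      rw [sub_ne_zero]
      exact hE
    obtain ⟨δ, hδ, hδφ⟩ : ∃ δ > 0, ∀ a : ℤ_[2], dist a 1 < δ → φ a ≠ 0 :=
      Metric.eventually_nhds_iff.mp (hφ.continuousAt.eventually_ne hφ1)
    obtain ⟨n, hn⟩ := exists_pow_lt_of_lt_one hδ (by norm_num : (1 / 2 : ℝ) < 1)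
    set M : ℕ := e + n with hM
    -- `d` by the Chinese remainder theorem
    have hco : Nat.Coprime (2 ^ M) Qd := Nat.Coprime.pow_left _ hQd
    obtain ⟨d, hd1, hd2⟩ := Nat.chineseRemainder hco c 1
    have hd2' : ¬ 2 ∣ d := by
      intro h
      have h1 : d ≡ c [MOD 2] := Nat.ModEq.of_dvd (dvd_pow_self 2 (by omega)) hd1
      have : 2 ∣ c := (Nat.ModEq.dvd_iff h1 (dvd_refl 2)).mp h
      exact hc2 this
    have hdQ : Nat.Coprime d (2 * Qd) := by
      refine Nat.Coprime.mul_right (Nat.coprime_two_right.mpr (Nat.odd_iff.mpr (Nat.two_dvd_ne_zero.mp hd2'))) ?_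
      rw [Nat.coprime_iff_gcd_eq_one, Nat.ModEq.gcd_eq hd2]
      exact Nat.gcd_one_left Qd
    obtain ⟨ud, hud⟩ := exists_unit_eq_natCast (p := 2) hd2'
    have hdmod : (d : ZMod (2 ^ e)) = 1 := by
      have h1 : d ≡ c [MOD 2 ^ e] := Nat.ModEq.of_dvd (pow_dvd_pow 2 (by omega : e ≤ M)) hd1
      rw [(ZMod.natCast_eq_natCast_iff _ _ _).mpr h1, hcmod]
    -- `ud = uc · v` with `v ≡ 1 (mod 2^M)`
    set v : ℤ_[2]ˣ := ud * uc⁻¹ with hv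
    have hv1 : (2 : ℤ_[2]) ^ M ∣ (v : ℤ_[2]) - 1 := by
      have hdc : ((2 : ℤ) ^ M) ∣ (d : ℤ) - c := (Nat.modEq_iff_dvd.mp hd1.symm)
      obtain ⟨m, hm⟩ := hdc
      refine ⟨(m : ℤ_[2]) * ((uc⁻¹ : ℤ_[2]ˣ) : ℤ_[2]), ?_⟩
      have hvu : (v : ℤ_[2]) = (ud : ℤ_[2]) * ((uc⁻¹ : ℤ_[2]ˣ) : ℤ_[2]) := by rw [hv, Units.val_mul]
      have h1 : (1 : ℤ_[2]) = (uc : ℤ_[2]) * ((uc⁻¹ : ℤ_[2]ˣ) : ℤ_[2]) := by rw [← Units.val_mul, mul_inv_cancel, Units.val_one]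
      rw [hvu, h1, ← sub_mul, hud, huc, ← mul_assoc]
      congr 1
      exact_mod_cast hm
    obtain ⟨b, hb⟩ := pow_dvd_ell_of_pow_dvd_sub_one (M := M) (by omega) v hv1
    set a : ℤ_[2] := 1 + 2 ^ n * b with ha
    have hell_d : ell 2 ud = K * a := by
      have : ud = uc * v := by rw [hv, mul_comm uc (ud * uc⁻¹), inv_mul_cancel_right]
      rw [this, ell_mul, hell_c, hb, ha, show M - 2 = (e - 2) + n by omega, pow_add, hK]
      push_cast
      ring
    -- the approximation is `δ`-close
    have hdist : dist a 1 < δ := by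
      rw [dist_eq_norm, ha, add_sub_cancel_left, norm_mul, norm_pow]
      refine lt_of_le_of_lt ?_ hn
      rw [one_div, inv_pow]
      have h2n : ‖(2 : ℤ_[2])‖ = 2⁻¹ := by
        have := PadicInt.norm_p (p := 2); simpa using this
      rw [h2n, inv_pow]
      exact mul_le_of_le_one_right (by positivity) (PadicInt.norm_le_one b)
    have hφa := hδφ a hdist
    -- `(1+T)^{ηℓ(d)}(z) ≠ d`
    have h4 : ‖(ud : ℤ_[2]) - 1‖ ≤ ‖(2 : ℤ_[2]) ^ 2‖ := by
      -- `d ≡ 5^K ≡ 1 (mod 4)`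
      have hd4 : d ≡ 1 [MOD 4] := by
        have h1 : d ≡ c [MOD 4] := Nat.ModEq.of_dvd ⟨2 ^ (M - 2), by
          rw [show (4 : ℕ) = 2 ^ 2 by norm_num, ← pow_add]; congr 1; omega⟩ hd1
        have h2' : c ≡ 1 [MOD 4] := by
          rw [hc]
          have : 5 ≡ 1 [MOD 4] := by decide
          simpa using this.pow K
        exact h1.trans h2'
      obtain ⟨m, hm⟩ := (Nat.modEq_iff_dvd' (by omega : 1 ≤ d)).mp hd4.symm
      have : (ud : ℤ_[2]) - 1 = (2 : ℤ_[2]) ^ 2 * m := by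
        rw [hud]
        have : (d : ℤ_[2]) = ((d - 1 : ℕ) : ℤ_[2]) + 1 := by
          rw [Nat.cast_sub (by omega : 1 ≤ d), Nat.cast_one]; ring
        rw [this, hm]; push_cast; ring
      rw [this, norm_mul]
      exact mul_le_of_le_one_right (norm_nonneg _) (PadicInt.norm_le_one _)
    have hcycd : cycPow 2 (ell 2 ud) = ud := cycPow_ell_eq_of_norm_sub_one_le ud h4
    have hgd_ne : ∑' k, ι (PowerSeries.coeff k (PowerSeries.binomialSeries ℤ_[2] (η * ell 2 ud))) * z ^ k ≠ ι (d : ℤ_[2]) := by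
      intro h
      apply hφa
      simp only [φ]
      rw [mul_assoc, ← hell_d, h, ← hud, ← hcycd, hell_d, sub_self]
    -- conclude
    refine ⟨c, d, uc, ud, 1, 1, huc, hud, by rw [Units.val_one, hcmod], by rw [Units.val_one, hdmod], hcQ, hdQ, ?_⟩
    rw [hgc, inv_one, mul_one, hιint, hιint, hιint, hιint]
    set gd := ∑' k, ι (PowerSeries.coeff k (PowerSeries.binomialSeries ℤ_[2] (η * ell 2 ud))) * z ^ k with hgd
    push_cast
    have hfac : (c : ℂ_[2]) ^ 2 * (d : ℂ_[2]) ^ 2 * (t 1 : ℂ_[2]) - (c : ℂ_[2]) * (d : ℂ_[2]) ^ 2 * (t 1 : ℂ_[2]) * w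
        - (c : ℂ_[2]) ^ 2 * (d : ℂ_[2]) * (t 1 : ℂ_[2]) * gd + (c : ℂ_[2]) * (d : ℂ_[2]) * (t 1 : ℂ_[2]) * w * gd =
        (t 1 : ℂ_[2]) * ((c : ℂ_[2]) * ((c : ℂ_[2]) - w)) * ((d : ℂ_[2]) * ((d : ℂ_[2]) - gd)) := by ring
    rw [hfac]
    have hc0 : (c : ℂ_[2]) ≠ 0 := by exact_mod_cast (show c ≠ 0 from fun h ↦ hc2 (h ▸ dvd_zero 2))
    have hd0 : (d : ℂ_[2]) ≠ 0 := by exact_mod_cast (show d ≠ 0 from fun h ↦ hd2' (h ▸ dvd_zero 2))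
    have ht0 : (t 1 : ℂ_[2]) ≠ 0 := by exact_mod_cast ht1
    have hcw : (c : ℂ_[2]) - w ≠ 0 := by
      rw [sub_ne_zero, ← hιnat, hc_cast]
      exact fun h ↦ hE h.symm
    have hdg : (d : ℂ_[2]) - gd ≠ 0 := by
      rw [sub_ne_zero, ← hιnat]
      exact fun h ↦ hgd_ne h.symm
    exact mul_ne_zero (mul_ne_zero ht0 (mul_ne_zero hc0 hcw)) (mul_ne_zero hd0 hdg)

end Summit.BirchSwinnertonDyer.BirchSwinnertonDyer.Theorems.SignedKatoOffTwo.CuspEval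

end
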